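import Summits.Ventures.QEC.Census.CertCoverBatch
import Summits.Ventures.QEC.Census.BB.A1s_n168_k6_e4fe5d68.CoreDefs
import HarnessLib

set_option Elab.async false
set_option maxRecDepth 200000

/-!
# `[[168,6,16]]` one-level cover certificate of `A1s_n168_k6_e4fe5d68` — LEVEL-1→0 coset problems 393…411 (deep problems [39] excluded: `ProbDeep*.lean`) as COMPACT data
(`ProbData`: U, f, σ, y₀, allow; qec-type-10 `CertCoverBatch.mkCoset` rebuilds each `CosetProb` in the kernel) + their verdict
`probsOK cov covR hx hx1 D1 lxd 14` (one `decide +kernel`; 19 problems, depths f=0:19 f=1:0 f=2:0 f=3:0, est. 66.5 s).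
qec-search-1 g5 (pattern of search-9 g5 `Probs*`); data from JSON `level10.problems` (sha256 1845b82baba6a9a5…). Data + decided check; KERNEL.
-/

namespace Summit.Ventures.QEC.Census.A1s_n168_k6_e4fe5d68

open Matrix Summit.Ventures.QEC.Census Literature.InformationTheory.QuantumCodes

/-- Problems 393…411 (19): `⟨U, f, σ, y₀, allow⟩`. -/
def probs09 : List ProbData := [
    ⟨38530664268923010023556, 0, 201808, 37940368458564438722726, []⟩,
    ⟨39559332032332393676800, 0, 571393, 1180879859889659449346, []⟩,
    ⟨40776870620527719358464, 0, 135437, 36600543065415810, []⟩,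
    ⟨42531355651489750253600, 0, 135691, 4722366483162783170577, []⟩,
    ⟨44872290480576390643744, 0, 267025, 4731598914952204518698, []⟩,
    ⟨47385092416966905301124, 0, 135186, 147573952889315361919, []⟩,
    ⟨56993819178060285608960, 0, 137323, 37781525936618566848768, []⟩,
    ⟨57270520206953816263744, 0, 4169, 57258990851171656271104, []⟩,
    ⟨57341996977442112143618, 0, 39049, 673598892666288293179, []⟩,
    ⟨57858510596511604281476, 0, 6341, 37788164813944824792533, []⟩,
    ⟨75866993513675421385216, 0, 75808, 75857623739328873168938, []⟩,
    ⟨75867281567994452674560, 0, 11313, 75857623598591384813578, []⟩,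
    ⟨76010243869750040201728, 0, 11313, 75862523514985966012458, []⟩,
    ⟨76159184938599121420324, 0, 532805, 545521802, []⟩,
    ⟨76176411813009686532104, 0, 10759, 4303619138, []⟩,
    ⟨76194566325321356017672, 0, 393221, 571746046443650, []⟩,
    ⟨76194925496445832274084, 0, 532805, 545521802, []⟩,
    ⟨76822641310594190573824, 0, 106633, 76748849830699792122897, []⟩,
    ⟨80442868843070846157320, 0, 107025, 4683884349954736160, []⟩]

set_option maxHeartbeats 400000000 in
/-- Every problem of this chunk passes (`mkCoset` elimination + `cosetOKD` + fast `σ` + depth + `BU`-evenness + label checks). -/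
theorem probs09_ok : probsOK A1s_n168_k6_e4fe5d68.cov covR hx hx1 D1 lxd 14 probs09 = true := by
  decide +kernel

/-- Pointwise form. -/
theorem probs09_all : ∀ x ∈ A1s_n168_k6_e4fe5d68.probs09, probOK cov covR hx hx1 D1 lxd 14 x = true := by
  have h := probs09_ok
  rwa [probsOK, List.all_eq_true] at h

end Summit.Ventures.QEC.Census.A1s_n168_k6_e4fe5d68
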